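import Summits.ResolutionOfSingularities.ResolutionOfSingularities.Theses.MaxContactCut
import Summits.ResolutionOfSingularities.ResolutionOfSingularities.Theorems.MaxContactCutTightDefect
import Summits.ResolutionOfSingularities.ResolutionOfSingularities.Theorems.ProximityCutKernels

/-!
# MaxContactCutProximityCut — the node «ProximityCut» wired to the route MaxContactCut BY NAME
(lens-3 g12 node «ProximityCut» rev 3a (sha256 3a2d1668… = rev 3 e1d6297007058045 + lint fix :1743);
CRITIC-LEDGER rows 79 / 83 / 84 (CLEARED, CLEARED-REV, CLEARED-REV3); by-name phase)

The proximity cut of the route item 31770 `MaxContactCut.DefectWalksDeep` (= `TightDefectClasses.DefectWalksTerminateDeep`,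
`MaxContactCutTightDefect.defectWalksDeep_iff`): lens §3 `defectWalksDeep_iff_prox` VERBATIM (:413–:417), and the same
`.trans` on the writer-rebased unconditional headline `ProximityCut.defectDeep_iff_four` (hR discharged by the landed
`BoundaryLedger.freeTailsAreCriticalDeep_holds`): 31770 ⟺ arc law `NoFreePointTailsDeep` [DECIDED desk] ∧ g11's bare line
`BoundaryLedger.NoBareTailsDeep` [KNOWN-MOD-PORT] ∧ g11's satellite column `BoundaryLedger.SatDefectWalksTerminateDeep`
[open] — EXACT.  ROOT BY NAME is the route's `closes` / `MaxContactCutExponentLadder.closes` (not restated).  The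
aside-level re-keyings (`PCNoFreePointTailsDeep`, `PCArcLawPort`) follow once the asides exist on the route.  0 sorry.
(Sources: Hauser2010 Lecture IX; CossartJannsenSaito2020 Cor. 5.37.)
-/

namespace Summit.ResolutionOfSingularities.ResolutionOfSingularities.Theorems.MaxContactCutProximityCut

open Summit.ResolutionOfSingularities.ResolutionOfSingularities.Theses
open Summit.ResolutionOfSingularities.ResolutionOfSingularities.Theorems
open ProximityCut BoundaryLedger

/-- … on the route's item 31770 BY NAME. [folklore] -/
theorem defectWalksDeep_iff_prox :
    MaxContactCut.DefectWalksDeep ↔ NoFreePointTailsDeep ∧ NoRecurrentProximityDeep :=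
  MaxContactCutTightDefect.defectWalksDeep_iff.trans defectDeep_iff_prox

/-- **THE LOCATED RESIDUAL OF 31770 BY NAME (EXACT, unconditional):** `MaxContactCut.DefectWalksDeep` ⟺ arc law ∧ g11's
bare line ∧ g11's satellite column. [folklore] -/
theorem defectWalksDeep_iff_four :
    MaxContactCut.DefectWalksDeep ↔ NoFreePointTailsDeep ∧ NoBareTailsDeep ∧ SatDefectWalksTerminateDeep :=
  MaxContactCutTightDefect.defectWalksDeep_iff.trans defectDeep_iff_four

end Summit.ResolutionOfSingularities.ResolutionOfSingularities.Theorems.MaxContactCutProximityCut
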